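import Summits.BirchSwinnertonDyer.Rank1Residual.Additive.X3BranchAnalyticHalfGordEndState
import HarnessLib

/-!
# X3♯(G-ord) at `p = 3` (twist by `−3`, defect `2` automatic), rank `0`, OFF the degenerate rows: the
# END STATE from PRINT + ONE displayed algebraic count — `Typed.MissingLowerBoundAt E 3` and
# `BSD(E,3)` off the CM / anomalous rows (cell `bsd-addord`, seat `bsd-addord-twist`; the `p = 3`
# sibling of `X3BranchAnalyticHalfGordEndState.lean`)

HONEST FRAMING (cell `bsd-addord`, `run/shared/lean/pub/bsd-addord/README.md` §4): the programme's
target of record is the full Birch–Swinnerton-Dyer formula for every `E/ℚ` of analytic rank `≤ 1`;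
this file concerns the X3 rows of cell (G-ord, `e = 2`) of N10/N11 at `p = 3` only and books
NOTHING: X3 stays CONSTRUCTION-SHAPED. THEOREMS ONLY (no `def`, no named fact, no `sorry`). PUBLISHED
inputs, explicit binders passed verbatim to team n1011's `p = 3` consumers
(`X3BranchLowerEndState[Thm16].lean` §3): `hW16` Wuthrich 2014 Thm. 16 (half-eigen reading; the
minus-eigen reading at `3` of the upper chain is derived from it in the tree); `hGV` Greenberg–Vatsal
2000 Thm. (3.12) on the `ω`-branch at a good ordinary `3` (reading-fact p396718); `hDel3` Delbourgo
2002 at `p = 3`; `hDel98` Delbourgo 1998 Prop. 4; `hGZK`; `hmod` / `hmodD`. The ONE unprinted input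
is the DISPLAYED hypothesis `hAlg` (Greenberg–Vatsal's algebraic residual count on the `ω`-branch for
every twist model `E ⊗ χ_{−3}`; seat memo App. A / cell `bsd-eis` x3-MEMO-2; never asserted).

## Scope at `p = 3` (honest)

At `p = 3` the branch character is `χ = χ_{−3} = ω` (odd, `m = 1`): the constituents of `E[3]` are
`χψ` (`= ω` on inertia) and `χφ` (`= ω² = 1` on inertia). GV's Thm. (3.12) / Props. (2.6), (2.8)
need `χφ ≠ 1` and `χψ ≠ ω` as GLOBAL characters, i.e. `{χφ, χψ} ≠ {1, ω}` — the hypothesis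
"`Γ_ℚ` acts non-trivially on `Φ₀`" (`hnt`) of the reading-fact. The EXCLUDED degenerate rows
(`E` with a rational `3`-torsion point or `μ₃ ⊂ E` up to `3`-isogeny on the additive side) are the
BULK of X3 ∩ `e = 2` at `3` (121 of 155 pairs with `N ≤ 3000`, cell `bsd-eis` x3 census; the
pole-corrected law there is x3's R3, not in print and not here). So these theorems speak to the
NON-degenerate parity-OK rows at `3` only (10 of 155 in that census).

## Contents

* `ClassX3Gord.forall_x3BranchMainConjecture_three_of_thm312_of_algebraicCount` — the `ω`-branch
  main conjecture of every twist model `V` (`C • V^{(−3)} = W`; good ordinary at `3` by the tree's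
  `goodOrd_twist_three_of_typeGOrd`) from `hW16 ∧ hGV ∧ hAlg`;
* `ClassX3Gord.missingLowerBoundAt_three_rankZero_of_thm312_of_algebraicCount_of_nonAnomalous`,
  `ClassX3Gord.bsdp_three_rankZero_of_thm312_of_algebraicCount_of_nonAnomalous` — `r_an = 0`,
  non-CM, non-anomalous: `Typed.MissingLowerBoundAt W 3`, `BSDp W 3`.

References: [GreenbergVatsal2000] §2 pp. 28–29, §3 Thm. (3.12) p. 45, p. 43 ("`L(s,G)` is
holomorphic (`ψ ≠ 1`)"); [Wuthrich2014] Thm. 16; [Delbourgo2002] Theorems (A), (B);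
[Delbourgo1998] Prop. 4; [Pal2012] Thm. 3.2 (`d < 0`, a tree theorem at `3`).
-/

set_option autoImplicit false

noncomputable section

open scoped Classical MatrixGroups ModularForm

namespace Summit.BirchSwinnertonDyer.Rank1Residual.Additive

open CongruenceSubgroup WeierstrassCurve NumberField IsDedekindDomain Field
  Literature.NumberTheory.EllipticCurves
  Literature.NumberTheory.EllipticCurves.ModularForms
  Literature.NumberTheory.EllipticCurves.GreenbergVatsal2000
  Literature.NumberTheory.EllipticCurves.Rank1Residual
  Literature.NumberTheory.EllipticCurves.Rank1Residual.Typed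
  Literature.NumberTheory.GaloisRepresentations
  Summit.BirchSwinnertonDyer.Rank1Residual.X1.MuLambda
  Summit.BirchSwinnertonDyer.Rank1Residual.AdditivePotMult
  Summit.BirchSwinnertonDyer.Rank1Residual.Additive.X3Branch

section Three

variable {W : WeierstrassCurve ℚ} [W.IsElliptic] [W.IsGloballyMinimal]

/-- **X3♯(G-ord) at `3`: the `ω`-branch main conjecture of EVERY twist model `V` (`C • V^{(−3)} = W`)
from Wuthrich Thm. 16 (`hW16`) ∧ GV Thm. (3.12) on the branch (`hGV`) ∧ the displayed algebraic
residual count `hAlg`** — the sibling's `X3Branch.mainConjectureAt_of_thm312_of_algebraicCount` at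
`p = 3` (`(−1)^{⌊3/2⌋}·3 = −3`; every twist model is good ordinary at `3` by the tree's
`goodOrd_twist_three_of_typeGOrd`). Data on `W`: `Σ₀ ∌ 3` finite with the bad places `≠ 3` inside;
`Φ₀ ≤ W[3]` a rational line, EVEN, with NON-TRIVIAL `Γ_ℚ`-action (excludes the degenerate rows) and
`χ_{−3}`-twist ramified at `3`. NOT a class theorem (`hAlg` OPEN).
[cite: GreenbergVatsal2000, p. 4, §2 (16) pp. 28–29, §3 Thm. (3.12) p. 45] [cite: Wuthrich2014, Thm. 16 (p. 397)] -/
theorem ClassX3Gord.forall_x3BranchMainConjecture_three_of_thm312_of_algebraicCount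
    [hp : Fact (Nat.Prime 3)]
    (hW16 : Wuthrich2014.thm16_halfEigenCharIdeal_dvd_cyclotomicPrime)
    (hGV : thm312_branch_unitContent_and_lambda_eq_residual_goodOrd)
    (hX : ClassX3Gord W 3)
    (S₀ : Finset (HeightOneSpectrum (𝓞 ℚ))) (hS₀ : ∀ v ∈ S₀, (((3 : ℕ) : ℕ) : 𝓞 ℚ) ∉ v.asIdeal)
    (hS : ∀ v : HeightOneSpectrum (𝓞 ℚ), v ∉ S₀ → (((3 : ℕ) : ℕ) : 𝓞 ℚ) ∉ v.asIdeal →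
      W.HasGoodReductionAt v)
    (Φ₀ : AddSubgroup (W.geomTorsion ((3 : ℕ) : ℤ))) (hΦ : IsRationalLine W 3 Φ₀)
    (heven : LineEven W 3 Φ₀)
    (hnt : ∃ (σ : absoluteGaloisGroup ℚ) (P : W.geomTorsion ((3 : ℕ) : ℤ)), P ∈ Φ₀ ∧ σ • P ≠ P)
    (hram : ∀ (K : Type) [Field K] [NumberField K] [(galRange (K := ℚ) K).Normal],
      Module.finrank ℚ K = 2 →
      (∃ θ : K, θ ^ 2 = algebraMap ℚ K ((-1) ^ ((3 : ℕ) / 2) * (3 : ℕ))) →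
      ¬ ∀ v : HeightOneSpectrum (𝓞 ℚ), (((3 : ℕ) : ℕ) : 𝓞 ℚ) ∈ v.asIdeal →
        ∀ 𝔓 ∈ v.primesAbove, ∀ σ ∈ 𝔓.inertia (absoluteGaloisGroup ℚ), ∀ P ∈ Φ₀,
          σ • P = (if σ ∈ galRange (K := ℚ) K then P else -P))
    (hAlg : ∀ (V : WeierstrassCurve ℚ) [V.IsElliptic] [V.IsGloballyMinimal],
      (∃ C : VariableChange ℚ, C • V.quadraticTwist (-3 : ℚ) = W) →
      ∀ (K : Type) [Field K] [NumberField K] [(galRange (K := ℚ) K).Normal]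
      (F : Type) [Field F] [NumberField F] [IsCyclotomicExtension {3} ℚ F]
      [(galRange (K := ℚ) F).Normal]
      {κ : ZpExtension ℚ 3} {γ : Field.absoluteGaloisGroup ℚ},
      (3 : ℕ) ≠ 2 → Module.finrank ℚ K = 2 →
      (∃ θ : K, θ ^ 2 = algebraMap ℚ K ((-1) ^ ((3 : ℕ) / 2) * (3 : ℕ))) →
      ¬ V.HasIrreducibleModPGaloisRep 3 →
      κ.IsCyclotomic → κ.IsTopGenerator γ → IsCyclotomicVariable 3 γ →
      γ ∈ galRange (K := ℚ) K → γ ∈ galRange (K := ℚ) F →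
      ∀ (D : V.EigenSelmerDualData 3
          (κ.kerSubgroup ⊓ galRange (K := ℚ) K ⊓ galRange (K := ℚ) F) κ.kerSubgroup
          (fun g ↦ if g ∈ galRange (K := ℚ) K then 1 else -1) γ)
        (g : IwasawaAlgebra 3), D.charIdeal = Ideal.span {g} → HasUnitContent g →
          3 ^ (lam g + ∑ v ∈ S₀, delta W 3 v) =
            Nat.card (residualLineH1 W 3 κ S₀ Φ₀ hΦ) * Nat.card (residualQuotSelmer W 3 κ S₀ Φ₀ hΦ)) :
    ∀ (V : WeierstrassCurve ℚ) [V.IsElliptic] [V.IsGloballyMinimal],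
      (∃ C : VariableChange ℚ, C • V.quadraticTwist (-3 : ℚ) = W) → X3BranchMainConjectureAt V 3 := by
  intro V _ _ hVW
  have hVW' : ∃ C : VariableChange ℚ, C • V.quadraticTwist ((-1) ^ ((3 : ℕ) / 2) * (3 : ℕ) : ℚ) = W := by
    rw [show ((-1 : ℚ) ^ ((3 : ℕ) / 2) * ((3 : ℕ) : ℚ)) = -3 by norm_num]; exact hVW
  have hgood : GoodOrd V 3 := by
    obtain ⟨C, hC⟩ := hVW'
    obtain ⟨C₁, hC₁⟩ := exists_variableChange_twist_of_model_twist V (pStar_ne_zero 3) hC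
    exact goodOrd_twist_three_of_typeGOrd W hX.typeGOrd hX.addv V ⟨C₁, hC₁⟩
  exact X3Branch.mainConjectureAt_of_thm312_of_algebraicCount hW16 hGV hgood hVW' S₀ hS₀ hS Φ₀ hΦ heven
    hnt hram (hAlg V hVW)


/-- **X3♯(G-ord) at `3`, `r_an = 0`, non-CM, OFF the anomalous and degenerate rows:
`Typed.MissingLowerBoundAt W 3` from PRINT + the displayed algebraic count** — the previous theorem
into team n1011's `ClassX3Gord.missingLowerBoundAt_three_rankZero_of_forall_x3BranchMainConjecture_of_nonAnomalous`
(Delbourgo 2002 at `3`, `hDel3`; GZK; modularity). NOT a class theorem; nothing booked.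
[cite: Delbourgo2002, Theorem (A), (B) (p. 40)] [cite: GreenbergVatsal2000, §3 Thm. (3.12) p. 45]
[cite: Wuthrich2014, Thm. 16 (p. 397)] [cite: Miller2011LMS, Def. 1.1] -/
theorem ClassX3Gord.missingLowerBoundAt_three_rankZero_of_thm312_of_algebraicCount_of_nonAnomalous
    [hp : Fact (Nat.Prime 3)]
    (hW16 : Wuthrich2014.thm16_halfEigenCharIdeal_dvd_cyclotomicPrime)
    (hGV : thm312_branch_unitContent_and_lambda_eq_residual_goodOrd)
    (hDel3 : Delbourgo2002.mainTheorem_three)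
    (hGZK : rank_eq_analyticRank_of_analyticRank_le_one) (hmod : hasEntireLFunction_rat)
    (hmodD : nonempty_modularParametrizationData)
    (hX : ClassX3Gord W 3) (hcm : ¬ W.HasCM) (hr : W.analyticRank = 0)
    (hna : Delbourgo2002.ReductionNonAnomalous W 3)
    (S₀ : Finset (HeightOneSpectrum (𝓞 ℚ))) (hS₀ : ∀ v ∈ S₀, (((3 : ℕ) : ℕ) : 𝓞 ℚ) ∉ v.asIdeal)
    (hS : ∀ v : HeightOneSpectrum (𝓞 ℚ), v ∉ S₀ → (((3 : ℕ) : ℕ) : 𝓞 ℚ) ∉ v.asIdeal →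
      W.HasGoodReductionAt v)
    (Φ₀ : AddSubgroup (W.geomTorsion ((3 : ℕ) : ℤ))) (hΦ : IsRationalLine W 3 Φ₀)
    (heven : LineEven W 3 Φ₀)
    (hnt : ∃ (σ : absoluteGaloisGroup ℚ) (P : W.geomTorsion ((3 : ℕ) : ℤ)), P ∈ Φ₀ ∧ σ • P ≠ P)
    (hram : ∀ (K : Type) [Field K] [NumberField K] [(galRange (K := ℚ) K).Normal],
      Module.finrank ℚ K = 2 →
      (∃ θ : K, θ ^ 2 = algebraMap ℚ K ((-1) ^ ((3 : ℕ) / 2) * (3 : ℕ))) →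
      ¬ ∀ v : HeightOneSpectrum (𝓞 ℚ), (((3 : ℕ) : ℕ) : 𝓞 ℚ) ∈ v.asIdeal →
        ∀ 𝔓 ∈ v.primesAbove, ∀ σ ∈ 𝔓.inertia (absoluteGaloisGroup ℚ), ∀ P ∈ Φ₀,
          σ • P = (if σ ∈ galRange (K := ℚ) K then P else -P))
    (hAlg : ∀ (V : WeierstrassCurve ℚ) [V.IsElliptic] [V.IsGloballyMinimal],
      (∃ C : VariableChange ℚ, C • V.quadraticTwist (-3 : ℚ) = W) →
      ∀ (K : Type) [Field K] [NumberField K] [(galRange (K := ℚ) K).Normal]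
      (F : Type) [Field F] [NumberField F] [IsCyclotomicExtension {3} ℚ F]
      [(galRange (K := ℚ) F).Normal]
      {κ : ZpExtension ℚ 3} {γ : Field.absoluteGaloisGroup ℚ},
      (3 : ℕ) ≠ 2 → Module.finrank ℚ K = 2 →
      (∃ θ : K, θ ^ 2 = algebraMap ℚ K ((-1) ^ ((3 : ℕ) / 2) * (3 : ℕ))) →
      ¬ V.HasIrreducibleModPGaloisRep 3 →
      κ.IsCyclotomic → κ.IsTopGenerator γ → IsCyclotomicVariable 3 γ →
      γ ∈ galRange (K := ℚ) K → γ ∈ galRange (K := ℚ) F →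
      ∀ (D : V.EigenSelmerDualData 3
          (κ.kerSubgroup ⊓ galRange (K := ℚ) K ⊓ galRange (K := ℚ) F) κ.kerSubgroup
          (fun g ↦ if g ∈ galRange (K := ℚ) K then 1 else -1) γ)
        (g : IwasawaAlgebra 3), D.charIdeal = Ideal.span {g} → HasUnitContent g →
          3 ^ (lam g + ∑ v ∈ S₀, delta W 3 v) =
            Nat.card (residualLineH1 W 3 κ S₀ Φ₀ hΦ) * Nat.card (residualQuotSelmer W 3 κ S₀ Φ₀ hΦ)) :
    MissingLowerBoundAt W 3 :=
  ClassX3Gord.missingLowerBoundAt_three_rankZero_of_forall_x3BranchMainConjecture_of_nonAnomalous hDel3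
    hGZK hmod hmodD hX hcm hr hna
    (ClassX3Gord.forall_x3BranchMainConjecture_three_of_thm312_of_algebraicCount hW16 hGV hX S₀ hS₀ hS Φ₀
      hΦ heven hnt hram hAlg)

/-- **X3♯(G-ord) at `3`, `r_an = 0`, non-CM, OFF the anomalous and degenerate rows: `BSD(E,3)`
from PRINT + the displayed algebraic count** — into team n1011's
`ClassX3Gord.bsdp_three_rankZero_of_forall_x3BranchMainConjecture_of_nonAnomalous_of_thm16` (lower:
Delbourgo 2002 at `3`, `hDel3`; upper: the minus-eigen Wuthrich chain at `3` derived from `hW16`, with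
Delbourgo 1998 Prop. 4 `hDel98`). No image / Tamagawa / Manin / `#Ш_an` hypothesis. NOT a class
theorem; nothing booked. [cite: Delbourgo2002, Theorem (A), (B) (p. 40)] [cite: Delbourgo1998, Prop. 4 (p. 144)]
[cite: Wuthrich2014, Thm. 16 (p. 397)] [cite: GreenbergVatsal2000, §3 Thm. (3.12) p. 45]
[cite: Miller2011LMS, §1 and Def. 1.1] -/
theorem ClassX3Gord.bsdp_three_rankZero_of_thm312_of_algebraicCount_of_nonAnomalous
    [hp : Fact (Nat.Prime 3)]
    (hW16 : Wuthrich2014.thm16_halfEigenCharIdeal_dvd_cyclotomicPrime)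
    (hGV : thm312_branch_unitContent_and_lambda_eq_residual_goodOrd)
    (hDel3 : Delbourgo2002.mainTheorem_three)
    (hDel98 : Delbourgo1998.prop4_rankZero_pow_dvd_constantCoeff)
    (hGZK : rank_eq_analyticRank_of_analyticRank_le_one) (hmod : hasEntireLFunction_rat)
    (hmodD : nonempty_modularParametrizationData)
    (hX : ClassX3Gord W 3) (hcm : ¬ W.HasCM) (hr : W.analyticRank = 0)
    (hna : Delbourgo2002.ReductionNonAnomalous W 3)
    (S₀ : Finset (HeightOneSpectrum (𝓞 ℚ))) (hS₀ : ∀ v ∈ S₀, (((3 : ℕ) : ℕ) : 𝓞 ℚ) ∉ v.asIdeal)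
    (hS : ∀ v : HeightOneSpectrum (𝓞 ℚ), v ∉ S₀ → (((3 : ℕ) : ℕ) : 𝓞 ℚ) ∉ v.asIdeal →
      W.HasGoodReductionAt v)
    (Φ₀ : AddSubgroup (W.geomTorsion ((3 : ℕ) : ℤ))) (hΦ : IsRationalLine W 3 Φ₀)
    (heven : LineEven W 3 Φ₀)
    (hnt : ∃ (σ : absoluteGaloisGroup ℚ) (P : W.geomTorsion ((3 : ℕ) : ℤ)), P ∈ Φ₀ ∧ σ • P ≠ P)
    (hram : ∀ (K : Type) [Field K] [NumberField K] [(galRange (K := ℚ) K).Normal],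
      Module.finrank ℚ K = 2 →
      (∃ θ : K, θ ^ 2 = algebraMap ℚ K ((-1) ^ ((3 : ℕ) / 2) * (3 : ℕ))) →
      ¬ ∀ v : HeightOneSpectrum (𝓞 ℚ), (((3 : ℕ) : ℕ) : 𝓞 ℚ) ∈ v.asIdeal →
        ∀ 𝔓 ∈ v.primesAbove, ∀ σ ∈ 𝔓.inertia (absoluteGaloisGroup ℚ), ∀ P ∈ Φ₀,
          σ • P = (if σ ∈ galRange (K := ℚ) K then P else -P))
    (hAlg : ∀ (V : WeierstrassCurve ℚ) [V.IsElliptic] [V.IsGloballyMinimal],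
      (∃ C : VariableChange ℚ, C • V.quadraticTwist (-3 : ℚ) = W) →
      ∀ (K : Type) [Field K] [NumberField K] [(galRange (K := ℚ) K).Normal]
      (F : Type) [Field F] [NumberField F] [IsCyclotomicExtension {3} ℚ F]
      [(galRange (K := ℚ) F).Normal]
      {κ : ZpExtension ℚ 3} {γ : Field.absoluteGaloisGroup ℚ},
      (3 : ℕ) ≠ 2 → Module.finrank ℚ K = 2 →
      (∃ θ : K, θ ^ 2 = algebraMap ℚ K ((-1) ^ ((3 : ℕ) / 2) * (3 : ℕ))) →
      ¬ V.HasIrreducibleModPGaloisRep 3 →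
      κ.IsCyclotomic → κ.IsTopGenerator γ → IsCyclotomicVariable 3 γ →
      γ ∈ galRange (K := ℚ) K → γ ∈ galRange (K := ℚ) F →
      ∀ (D : V.EigenSelmerDualData 3
          (κ.kerSubgroup ⊓ galRange (K := ℚ) K ⊓ galRange (K := ℚ) F) κ.kerSubgroup
          (fun g ↦ if g ∈ galRange (K := ℚ) K then 1 else -1) γ)
        (g : IwasawaAlgebra 3), D.charIdeal = Ideal.span {g} → HasUnitContent g →
          3 ^ (lam g + ∑ v ∈ S₀, delta W 3 v) =
            Nat.card (residualLineH1 W 3 κ S₀ Φ₀ hΦ) * Nat.card (residualQuotSelmer W 3 κ S₀ Φ₀ hΦ)) :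
    BSDp W 3 :=
  ClassX3Gord.bsdp_three_rankZero_of_forall_x3BranchMainConjecture_of_nonAnomalous_of_thm16 hW16 hDel3
    hDel98 hGZK hmod hmodD hX hcm hr hna
    (ClassX3Gord.forall_x3BranchMainConjecture_three_of_thm312_of_algebraicCount hW16 hGV hX S₀ hS₀ hS Φ₀
      hΦ heven hnt hram hAlg)

end Three

end Summit.BirchSwinnertonDyer.Rank1Residual.Additive

end
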